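/-
HODGE LADDER — STAGE 4: the strict road (S) at its base — CURVES, THEIR POWERS AND PRODUCTS.  A smooth projective
complex curve is dominated, through algebraic correspondences, by the powers of its Jacobian (Arapura 2006, §1
Lemma 1.3: "`X` and its Jacobian `J(X)` are co-motivated … Since `α^*` induces a surjection on cohomology, `X` is also
motivated by `J(X)`"), and domination by abelian varieties is stable under products; hence `HC_AV` ALONE gives the
Hodge conjecture for every product of smooth projective complex curves and for all powers of such a product — by
KERNEL theorems, with NO Literature record (literature seat hodge-director-lit-stage4, gen 12).  Theorems only: no
definition, no named fact, no new target.  Companion document run/shared/lean/pub/hodge-director/STAGE4-ABELIAN-MOTIVIC-TYPE.md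
(v12, §15).
-/
import Summits.HodgeConjecture.CorCM.Stage4StrictRoadDischargePowers
import Literature.AlgebraicGeometry.HodgeTheory.FermatHodgeClassesLiftToCurveAndJacobianPowersProofs
import Literature.AlgebraicGeometry.Motives.JacobianFirstCohomologyHolds
import Literature.AlgebraicGeometry.Motives.JacobianExistenceComplex
import Literature.AlgebraicGeometry.Motives.AbelianVarietyProductDimProofs
import HarnessLib

/-!
# Stage 4 — the strict road at its base: curves, their powers and products inherit the Hodge conjecture from `HC_AV`

The strict sense of «abelian motivic type» (companion document §0-bis; Arapura, Adv. Math. 207 (2006)): `Y` is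
(strongly) motivated by an abelian variety `A` — on the tree's real carriers `HodgeTheory.IsDominatedByPowers dY Y A.dim A.X`
(every `Hᵏ(Y(ℂ); ℂ)` is spanned by images of algebraic correspondences from the cartesian powers `Aᵉ`) — and then
`HC_AV` ALONE yields the Hodge conjecture for `Y` and all its powers (Arapura Lemma 4.2; KERNEL theorem
`hc_of_isDominatedByPowers_abelianVariety_holds` of `CorCM/Stage4StrictRoadDischargePowers`, the Arapura record being
discharged since gen 7).  The printed base case of the road is the curve: Arapura 2006 §1 Lemma 1.3 ("If `X` is a
smooth projective curve, `X` and its Jacobian `J(X)` are co-motivated"; proof: "Since `α^*` induces a surjection on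
cohomology, `X` is also motivated by `J(X)`", `α` the Abel–Jacobi map), resting on `α^* : H¹(J, ℚ) ≅ H¹(C, ℚ)`
(Lange 2023 §4.1.1 and proof of Lemma 4.4.1; Milne 1986 Thm. 2.5) — in the tree the DISCHARGED fact
`Motives.isIso_bettiCohomology_map_abelJacobi` (`…_holds`, `Motives/JacobianFirstCohomologyHolds`), already turned
into "`(f^P)^*` is onto `Hᵏ(C(ℂ); ℂ)` in every degree" by `HodgeTheory.surjective_complexBetti_map_abelJacobi`
(`HodgeTheory/FermatHodgeClassesLiftToCurveAndJacobianPowersProofs`, genus `≥ 1`).  This file records, as kernel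
theorems and with no record at all:

* `span_eq_top_of_surjective_complexBetti_map` — a morphism `f : Y ⟶ Xᵉ` with `f^*` onto `Hᵏ(Y(ℂ); ℂ)` puts `Hᵏ` in
  the domination span (`f^*` is an algebraic correspondence, `isAlgebraicCorrespondence_map`);
* `mem_span_of_mem_algebraicClasses` — algebraic classes of `Y` lie in the domination span (the `e = 0` term:
  `α = t^* 1 ∪ α` for `t : Y → Spec ℂ = X⁰`, a composite of two algebraic correspondences);
* `isDominatedByPowers_of_retraction` — domination by the powers of `A` passes to the powers of any `A'` of which
  `A` is a retract (`ι ≫ π = 𝟙`: `(ιᵉ)^*` is an algebraic correspondence and onto); whence, a smooth projective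
  complex variety having a complex point, `isDominatedByPowers_of_left_factor` / `_of_right_factor` and, with
  `isDominatedByPowers_tensor` (gen 7), `isDominatedByPowers_tensor_prod`: `Y`, `Y'` dominated by abelian varieties
  `A`, `B` ⟹ `Y ⊗ Y'` dominated by `A × B` (`AbelianVariety.prod`, `dim_prod`);
* `isDominatedByPowers_self`, `isDominatedByPowers_curve_jacobian` — a variety is dominated by its own powers;
  **a smooth projective complex curve is dominated by the powers of its Jacobian** (degree `0`: units; degree `1`:
  `(f^P)^*` onto, or `H¹ = 0`; degree `2`: top-degree classes are algebraic, `mem_algebraicClasses_of_degree_top`;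
  degrees `≥ 3` vanish);
* consequences from `HC_AV` alone: `hc_curve_powers_of_hc_av` (every curve and ALL ITS POWERS `Cᵐ`),
  `hc_of_exists_isDominatedByPowers_abelianVariety` with the closure lemmas `exists_isDominatedByPowers_curve`,
  `_abelianVariety`, `_tensor` (so every finite product of curves and abelian varieties, any bracketing), and the
  two-curve instance `hc_curve_tensor_curve_of_hc_av` (`C₁ × C₂` and all its powers).

What this gives the ladder (companion document §15): the products `X₁ × ⋯ × X_r` of smooth projective curves — in
particular of (compactified) modular curves and of Shimura curves, the simplest Shimura varieties of abelian type
(row 5) — inherit the Hodge conjecture from `HC_AV` with NOTHING ELSE, in the kernel; the open content there is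
`HC_AV` for the products of the Jacobians (dimension `≥ 4`).  Nothing is asserted about `HC_AV`.
[cite: Arapura2006, §1 Lemma 1.1, Lemma 1.3 and §4 Lemma 4.2] [cite: Lange2023AbelianVarietiesC, §4.1.1 and Lemma 4.4.1 (proof)]
[cite: Milne1986JacobianVarieties, §2 Thm. 2.5]
-/

noncomputable section

namespace Summit.HodgeConjecture.CorCM.Stage4

open CategoryTheory MonoidalCategory CartesianMonoidalCategory
open Literature.AlgebraicGeometry Literature.AlgebraicGeometry.Motives Literature.AlgebraicGeometry.HodgeTheory
open Literature.AlgebraicTopology.SingularHomology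
open Summit.HodgeConjecture.HodgeConjecture.Ring2.AbelianAll (IsAlgebraicCorrespondence.comp)

/-! ## §1 Generators of the domination span -/

section Span

variable {dX dY : ℕ} {X Y : SchemeOver ℂ}

/-- **A morphism `f : Y ⟶ Xᵉ` whose pull-back is onto `Hᵏ(Y(ℂ); ℂ)` puts all of `Hᵏ` in the domination span**:
`f^*` is induced by an algebraic correspondence (the graph, `isAlgebraicCorrespondence_map`; André 1996 §2.1), so its
range is among the generators of `IsDominatedByPowers` (Arapura 2006 §1, Lemma 1.1 / Cor. 1.2: a morphism inducing a
surjection on cohomology).  Degrees `k > 2 dim Y` carry no classes. [cite: Arapura2006, §1 Lemma 1.1 and Cor. 1.2]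
[cite: Andre1996Motifs, §2.1 (p. 15)] -/
theorem span_eq_top_of_surjective_complexBetti_map (hX : IsSmoothProjective dX X) (hY : IsSmoothProjective dY Y)
    {k e : ℕ} (f : Y ⟶ X.pow e) (hf : Function.Surjective (complexBetti.map f k).hom) :
    Submodule.span ℂ
        {c : complexBetti Y k |
          ∃ (e a : ℕ) (T : complexBetti (X.pow e) a →ₗ[ℂ] complexBetti Y k),
            IsAlgebraicCorrespondence dY (e * dX) Y (X.pow e) T ∧ c ∈ LinearMap.range T} = ⊤ := by
  refine eq_top_iff.2 fun c _ ↦ ?_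
  by_cases hk : k ≤ 2 * dY
  · obtain ⟨x, rfl⟩ := hf c
    exact Submodule.subset_span
      ⟨e, k, (complexBetti.map f k).hom, isAlgebraicCorrespondence_map hY (hX.pow e) f hk, LinearMap.mem_range_self _ x⟩
  · haveI := subsingleton_complexBetti hY (k := k) (by omega)
    rw [Subsingleton.elim c 0]
    exact Submodule.zero_mem _

/-- **Algebraic classes lie in the domination span** (the term `e = 0`, `X⁰ = Spec ℂ`, of Arapura's
`⊕_{m,n} [X]^{⊗n}(m) → [Y]`): for `α ∈ Nᵖ H²ᵖ(Y(ℂ); ℂ)` the map `H⁰(Spec ℂ) → H²ᵖ(Y(ℂ))`, `u ↦ t^* u ∪ α`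
(`t : Y → Spec ℂ`), is a composite of two algebraic correspondences (`isAlgebraicCorrespondence_map`,
`isAlgebraicCorrespondence_flip_cupProduct_of_mem_algebraicClasses`, composed by `IsAlgebraicCorrespondence.comp`) and
sends `1` to `1 ∪ α = α`. [cite: Arapura2006, §1 Lemma 1.1] [cite: VoisinHodgeII2003, proof of Thm. 10.17 (10.7)] -/
theorem mem_span_of_mem_algebraicClasses (hX : IsSmoothProjective dX X) (hY : IsSmoothProjective dY Y) {p : ℕ}
    {α : complexBetti Y (2 * p)} (hα : α ∈ algebraicClasses Y p) :
    α ∈ Submodule.span ℂ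
        {c : complexBetti Y (2 * p) |
          ∃ (e a : ℕ) (T : complexBetti (X.pow e) a →ₗ[ℂ] complexBetti Y (2 * p)),
            IsAlgebraicCorrespondence dY (e * dX) Y (X.pow e) T ∧ c ∈ LinearMap.range T} := by
  by_cases hp : 2 * p ≤ 2 * dY
  swap
  · haveI := subsingleton_complexBetti hY (k := 2 * p) (by omega)
    rw [Subsingleton.elim α 0]
    exact Submodule.zero_mem _
  have h0 : IsSmoothProjective (0 * dX) (X.pow 0) := hX.pow 0
  -- `t : Y → Spec ℂ = X⁰`
  obtain ⟨t⟩ : Nonempty (Y ⟶ X.pow 0) := ⟨toUnit Y⟩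
  set T : complexBetti (X.pow 0) 0 →ₗ[ℂ] complexBetti Y (2 * p) :=
    (cupProduct (Nat.zero_add (2 * p))).flip α ∘ₗ (complexBetti.map t 0).hom with hT
  have hTalg : IsAlgebraicCorrespondence dY (0 * dX) Y (X.pow 0) T :=
    IsAlgebraicCorrespondence.comp hY hY h0 (isAlgebraicCorrespondence_map hY h0 t (Nat.zero_le _))
      (isAlgebraicCorrespondence_flip_cupProduct_of_mem_algebraicClasses hY (Nat.zero_add (2 * p)) hp hα) (by omega)
  refine Submodule.subset_span ⟨0, 0, T, hTalg, singularCohomology.one ℂ (ComplexPoints (X.pow 0)), ?_⟩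
  -- `T 1 = t^* 1 ∪ α = 1 ∪ α = α`
  rw [hT, LinearMap.comp_apply, LinearMap.flip_apply]
  change cupProduct _ (complexBetti.map t 0 (singularCohomology.one ℂ (ComplexPoints (X.pow 0)))) α = α
  have h1 : complexBetti.map t 0 (singularCohomology.one ℂ (ComplexPoints (X.pow 0))) =
      singularCohomology.one ℂ (ComplexPoints Y) :=
    singularCohomology.map_one (AlgPoints.mapContinuous (L := ℂ) t)
  rw [h1]
  exact one_cupProduct α

end Span

/-! ## §2 Domination is inherited along retractions of the dominating variety; factors of a product -/

section Retraction

variable {dA dA' dB dY : ℕ} {A A' B Y : SchemeOver ℂ}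

/-- `ι : A ⟶ A'` with a retraction `π` induces, on every cartesian power, a morphism `Aᵉ ⟶ A'ᵉ` with a retraction
(`ιᵉ = ι^{e-1} ⊗ ι`, `πᵉ = π^{e-1} ⊗ π`; functoriality of `⊗`). [folklore] -/
theorem exists_pow_retraction (ι : A ⟶ A') (π : A' ⟶ A) (h : ι ≫ π = 𝟙 A) :
    ∀ e : ℕ, ∃ (s : A.pow e ⟶ A'.pow e) (p : A'.pow e ⟶ A.pow e), s ≫ p = 𝟙 (A.pow e)
  | 0 => ⟨𝟙 _, 𝟙 _, Category.comp_id _⟩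
  | e + 1 => by
    obtain ⟨s, p, hsp⟩ := exists_pow_retraction ι π h e
    refine ⟨s ⊗ₘ ι, p ⊗ₘ π, ?_⟩
    change (s ⊗ₘ ι) ≫ (p ⊗ₘ π) = 𝟙 (A.pow e ⊗ A)
    rw [tensorHom_comp_tensorHom, hsp, h, id_tensorHom_id]

/-- **Domination by the powers of a retract**: if `Y` is dominated by the powers of `A`, and `A` is a retract of `A'`
(`ι ≫ π = 𝟙`), then `Y` is dominated by the powers of `A'` — precompose each generating correspondence
`T : Hᵃ(Aᵉ) → Hᵏ(Y)` with `(ιᵉ)^*`, an algebraic correspondence (`isAlgebraicCorrespondence_map`) which is onto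
(`(ιᵉ)^* ∘ (πᵉ)^* = 𝟙`); the composite is algebraic (`IsAlgebraicCorrespondence.comp`, Fulton Def. 16.1.1) with the
same range. [cite: Arapura2006, §1 Lemma 1.1 and §4 Lemma 4.2] [cite: Fulton1998, §16.1 Def. 16.1.1 and Prop. 16.1.1] -/
theorem isDominatedByPowers_of_retraction (hA : IsSmoothProjective dA A) (hA' : IsSmoothProjective dA' A')
    (ι : A ⟶ A') (π : A' ⟶ A) (h : ι ≫ π = 𝟙 A) (hY : IsSmoothProjective dY Y)
    (hdom : IsDominatedByPowers dY Y dA A) : IsDominatedByPowers dY Y dA' A' := by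
  intro k
  refine eq_top_iff.2 ?_
  rw [← hdom k]
  refine Submodule.span_le.2 ?_
  rintro _ ⟨e, a, T, hT, x, rfl⟩
  rw [SetLike.mem_coe]
  obtain ⟨s, p, hsp⟩ := exists_pow_retraction ι π h e
  -- `x = (ιᵉ)^* (πᵉ)^* x`
  have hx : x = complexBetti.map s a (complexBetti.map p a x) := by
    rw [← complexBetti.map_comp_apply', hsp, complexBetti.map_id]
    rfl
  by_cases ha : a ≤ 2 * (e * dA)
  swap
  · haveI := subsingleton_complexBetti (hA.pow e) (k := a) (by omega)
    rw [Subsingleton.elim x 0, map_zero]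
    exact Submodule.zero_mem _
  by_cases ha' : a ≤ 2 * (e * dA')
  swap
  · haveI := subsingleton_complexBetti (hA'.pow e) (k := a) (by omega)
    rw [hx, Subsingleton.elim (complexBetti.map p a x) 0, map_zero, map_zero]
    exact Submodule.zero_mem _
  have hs : IsAlgebraicCorrespondence (e * dA) (e * dA') (A.pow e) (A'.pow e) (complexBetti.map s a).hom :=
    isAlgebraicCorrespondence_map (hA.pow e) (hA'.pow e) s ha
  refine Submodule.subset_span ⟨e, a, T ∘ₗ (complexBetti.map s a).hom,
    IsAlgebraicCorrespondence.comp hY (hA.pow e) (hA'.pow e) hs hT (by omega), complexBetti.map p a x, ?_⟩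
  rw [LinearMap.comp_apply]
  exact congrArg T hx.symm

/-- **A factor with a complementary point**: `Y` dominated by the powers of `A` ⟹ `Y` dominated by the powers of
`A ⊗ B`, for `B` smooth projective (`B` has a complex point `b₀` — Nullstellensatz, the tree's
`IsSmoothProjective.nonempty_algPoints` —, and `a ↦ (a, b₀)` is a section of `pr_A`).
[cite: Arapura2006, §1 Lemma 1.1 and §4 Lemma 4.2] -/
theorem isDominatedByPowers_of_left_factor (hA : IsSmoothProjective dA A) (hB : IsSmoothProjective dB B)
    (hY : IsSmoothProjective dY Y) (hdom : IsDominatedByPowers dY Y dA A) :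
    IsDominatedByPowers dY Y (dA + dB) (A ⊗ B) := by
  obtain ⟨P⟩ := hB.nonempty_algPoints ℂ
  exact isDominatedByPowers_of_retraction hA (hA.tensor_holds hB) (lift (𝟙 A) (toUnit A ≫ P.toUnitHom)) (fst A B)
    (lift_fst _ _) hY hdom

/-- Same for the right factor: `Y` dominated by the powers of `B` ⟹ dominated by the powers of `A ⊗ B`
(`b ↦ (a₀, b)` is a section of `pr_B`). [cite: Arapura2006, §1 Lemma 1.1 and §4 Lemma 4.2] -/
theorem isDominatedByPowers_of_right_factor (hA : IsSmoothProjective dA A) (hB : IsSmoothProjective dB B)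
    (hY : IsSmoothProjective dY Y) (hdom : IsDominatedByPowers dY Y dB B) :
    IsDominatedByPowers dY Y (dA + dB) (A ⊗ B) := by
  obtain ⟨P⟩ := hA.nonempty_algPoints ℂ
  exact isDominatedByPowers_of_retraction hB (hA.tensor_holds hB) (lift (toUnit B ≫ P.toUnitHom) (𝟙 B)) (snd A B)
    (lift_snd _ _) hY hdom

/-- **Products**: `Y` dominated by the powers of the abelian variety `A` and `Y'` by those of `B` ⟹ `Y ⊗ Y'` is
dominated by the powers of the product abelian variety `A × B` (`AbelianVariety.prod`; `dim (A × B) = dim A + dim B`,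
`AbelianVariety.dim_prod`) — both factors pass to `A ⊗ B` (`_of_left_factor`, `_of_right_factor`) and products of
dominated varieties are dominated (`isDominatedByPowers_tensor`: Arapura §1, `M_A(X)` is a tensor category).
[cite: Arapura2006, §1 Lemma 1.1 and §4 Lemma 4.2] [cite: Milne1986AbelianVarieties, Conventions p. 103 and §1 p. 104] -/
theorem isDominatedByPowers_tensor_prod (A B : AbelianVariety ℂ) {dY dY' : ℕ} {Y Y' : SchemeOver ℂ}
    (hY : IsSmoothProjective dY Y) (hY' : IsSmoothProjective dY' Y') (hd : IsDominatedByPowers dY Y A.dim A.X)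
    (hd' : IsDominatedByPowers dY' Y' B.dim B.X) :
    IsDominatedByPowers (dY + dY') (Y ⊗ Y') (A.prod B).dim (A.prod B).X := by
  have hA : IsSmoothProjective A.dim A.X := AbelianVariety.isSmoothProjective_holds
  have hB : IsSmoothProjective B.dim B.X := AbelianVariety.isSmoothProjective_holds
  rw [AbelianVariety.dim_prod, AbelianVariety.prod_X]
  exact isDominatedByPowers_tensor (hA.tensor_holds hB) hY hY' (isDominatedByPowers_of_left_factor hA hB hY hd)
    (isDominatedByPowers_of_right_factor hA hB hY' hd')

end Retraction

/-! ## §3 A variety is dominated by its own powers; a curve by the powers of its Jacobian -/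

section Curves

variable {dX : ℕ} {X C : SchemeOver ℂ}

/-- **Every smooth projective complex variety is dominated by its own powers** (the identity correspondence:
`X¹ = Spec ℂ ⊗ X ≅ X`, pull-back along an isomorphism is onto). [cite: Arapura2006, §1 Lemma 1.1] -/
theorem isDominatedByPowers_self (hX : IsSmoothProjective dX X) : IsDominatedByPowers dX X dX X := fun k ↦
  span_eq_top_of_surjective_complexBetti_map hX hX (e := 1) (λ_ X).symm.hom
    (surjective_complexBetti_map_of_iso (λ_ X).symm k)

/-- **A smooth projective complex curve is dominated by the powers of its Jacobian** (Arapura 2006 §1 Lemma 1.3: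
"Since `α^*` induces a surjection on cohomology, `X` is also motivated by `J(X)`"): `H⁰(C(ℂ))` is reached from
`J⁰ = Spec ℂ` (units, `surjective_complexBetti_map_zero`); `H¹(C(ℂ))` from `J¹` along `f^P ≫ (λ_J)⁻¹`, onto by the
discharged `H¹`-fact `Motives.isIso_bettiCohomology_map_abelJacobi_holds` (Lange §4.1.1, `α^* : H¹(J) ≅ H¹(C)`;
`surjective_complexBetti_map_abelJacobi`) when `H¹(C(ℂ)) ≠ 0`, trivially when `H¹(C(ℂ)) = 0`; `H²(C(ℂ))` consists of
algebraic classes (top degree, `mem_algebraicClasses_of_degree_top`), which lie in the span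
(`mem_span_of_mem_algebraicClasses`); `Hᵏ(C(ℂ)) = 0` for `k ≥ 3`.  No record is used.
[cite: Arapura2006, §1 Lemma 1.3] [cite: Lange2023AbelianVarietiesC, §4.1.1 and Lemma 4.4.1 (proof)]
[cite: Milne1986JacobianVarieties, §2 Thm. 2.5] -/
theorem isDominatedByPowers_curve_jacobian (hC : IsSmoothProjective 1 C) (𝒥 : Jacobian C) :
    IsDominatedByPowers 1 C 𝒥.J.dim 𝒥.J.X := by
  have hJ : IsSmoothProjective 𝒥.J.dim 𝒥.J.X := AbelianVariety.isSmoothProjective_holds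
  intro k
  match k with
  | 0 =>
    exact span_eq_top_of_surjective_complexBetti_map hJ hC (e := 0) (toUnit C)
      (surjective_complexBetti_map_zero hC _)
  | 1 =>
    by_cases h1 : Nontrivial (complexBetti C 1)
    · obtain ⟨P⟩ := hC.nonempty_algPoints ℂ
      refine span_eq_top_of_surjective_complexBetti_map hJ hC (e := 1) (𝒥.abelJacobi P ≫ (λ_ 𝒥.J.X).symm.hom) ?_
      rw [complexBetti.map_comp, ModuleCat.hom_comp, LinearMap.coe_comp]
      exact (surjective_complexBetti_map_abelJacobi isIso_bettiCohomology_map_abelJacobi_holds hC 𝒥 P 1).comp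
        (surjective_complexBetti_map_of_iso (λ_ 𝒥.J.X).symm 1)
    · rw [not_nontrivial_iff_subsingleton] at h1
      exact eq_top_iff.2 fun c _ ↦ by
        rw [Subsingleton.elim c 0]
        exact Submodule.zero_mem _
  | 2 =>
    exact eq_top_iff.2 fun c _ ↦
      mem_span_of_mem_algebraicClasses hJ hC (p := 1) (mem_algebraicClasses_of_degree_top hC le_rfl c)
  | k + 3 =>
    haveI := subsingleton_complexBetti hC (k := k + 3) (by omega)
    exact eq_top_iff.2 fun c _ ↦ by
      rw [Subsingleton.elim c 0]
      exact Submodule.zero_mem _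

end Curves

/-! ## §4 Consequences from `HC_AV` alone (no record): curves, their powers, products -/

section Consequences

variable {dY dY' : ℕ} {Y Y' C C₁ C₂ : SchemeOver ℂ}

/-- **`HC_AV` ⟹ the Hodge conjecture for every smooth projective variety dominated by the powers of SOME complex
abelian variety, and for all its powers** (Arapura 2006 Lemma 4.2, kernel form
`hc_of_isDominatedByPowers_abelianVariety_holds`; existential packaging for the closure lemmas below).
[cite: Arapura2006, §4 Lemma 4.2 and §1 Lemma 1.1] -/
theorem hc_of_exists_isDominatedByPowers_abelianVariety (hAV : HC_AV) (hY : IsSmoothProjective dY Y)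
    (h : ∃ A : AbelianVariety ℂ, IsDominatedByPowers dY Y A.dim A.X) :
    HodgeConjectureFor dY Y ∧ ∀ m : ℕ, HodgeConjectureFor ((m + 1) * dY) (Y.pow (m + 1)) := by
  obtain ⟨A, hA⟩ := h
  exact hc_of_isDominatedByPowers_abelianVariety_holds hAV A hY hA

/-- Closure, base case 1: every smooth projective complex curve is dominated by the powers of an abelian variety (its
Jacobian, which EXISTS: `Motives.nonempty_jacobian_of_isSmoothProjective_complex`). [cite: Arapura2006, §1 Lemma 1.3]
[cite: Milne1986JacobianVarieties, §1 Thm. 1.1 and §2 Thm. 2.5] -/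
theorem exists_isDominatedByPowers_curve (hC : IsSmoothProjective 1 C) :
    ∃ A : AbelianVariety ℂ, IsDominatedByPowers 1 C A.dim A.X := by
  obtain ⟨𝒥⟩ := nonempty_jacobian_of_isSmoothProjective_complex C hC
  exact ⟨𝒥.J, isDominatedByPowers_curve_jacobian hC 𝒥⟩

/-- Closure, base case 2: an abelian variety is dominated by its own powers. [cite: Arapura2006, §1 Lemma 1.1] -/
theorem exists_isDominatedByPowers_abelianVariety (A : AbelianVariety ℂ) :
    ∃ B : AbelianVariety ℂ, IsDominatedByPowers A.dim A.X B.dim B.X :=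
  ⟨A, isDominatedByPowers_self AbelianVariety.isSmoothProjective_holds⟩

/-- Closure under products: `Y`, `Y'` dominated by (the powers of) abelian varieties ⟹ so is `Y ⊗ Y'` (by the
product abelian variety). [cite: Arapura2006, §1 Lemma 1.1 and §4 Lemma 4.2] -/
theorem exists_isDominatedByPowers_tensor (hY : IsSmoothProjective dY Y) (hY' : IsSmoothProjective dY' Y')
    (h : ∃ A : AbelianVariety ℂ, IsDominatedByPowers dY Y A.dim A.X)
    (h' : ∃ B : AbelianVariety ℂ, IsDominatedByPowers dY' Y' B.dim B.X) :
    ∃ A : AbelianVariety ℂ, IsDominatedByPowers (dY + dY') (Y ⊗ Y') A.dim A.X := by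
  obtain ⟨A, hA⟩ := h
  obtain ⟨B, hB⟩ := h'
  exact ⟨A.prod B, isDominatedByPowers_tensor_prod A B hY hY' hA hB⟩

/-- **`HC_AV` ⟹ the Hodge conjecture for every smooth projective complex curve and for ALL ITS POWERS `C^{m+1}`**
(dimension `m + 1`; open content: `m + 1 ≥ 4`) — Arapura 2006 Lemma 1.3 + Lemma 4.2 in the kernel, the `HC_AV`
input being the Hodge conjecture for the powers of the Jacobian.  No record. [cite: Arapura2006, §1 Lemma 1.3 and §4 Lemma 4.2] -/
theorem hc_curve_powers_of_hc_av (hAV : HC_AV) (hC : IsSmoothProjective 1 C) :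
    HodgeConjectureFor 1 C ∧ ∀ m : ℕ, HodgeConjectureFor ((m + 1) * 1) (C.pow (m + 1)) :=
  hc_of_exists_isDominatedByPowers_abelianVariety hAV hC (exists_isDominatedByPowers_curve hC)

/-- Same, every cartesian power `Cᵐ` (dimension `m`; `C⁰ = Spec ℂ` by `hodgeConjectureFor_of_dim_zero`).
[cite: Arapura2006, §1 Lemma 1.3 and §4 Lemma 4.2] -/
theorem hc_curve_pow_of_hc_av (hAV : HC_AV) (hC : IsSmoothProjective 1 C) (m : ℕ) :
    HodgeConjectureFor m (C.pow m) := by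
  cases m with
  | zero => exact hodgeConjectureFor_of_dim_zero (by simpa using hC.pow 0)
  | succ m => simpa using (hc_curve_powers_of_hc_av hAV hC).2 m

/-- **`HC_AV` ⟹ the Hodge conjecture for the product of two smooth projective complex curves and all its powers**
(e.g. products of modular curves; open content: the powers `(C₁ × C₂)^{m+1}`, `m ≥ 1`).
[cite: Arapura2006, §1 Lemma 1.3 and §4 Lemma 4.2] -/
theorem hc_curve_tensor_curve_of_hc_av (hAV : HC_AV) (hC₁ : IsSmoothProjective 1 C₁) (hC₂ : IsSmoothProjective 1 C₂) :
    HodgeConjectureFor 2 (C₁ ⊗ C₂) ∧ ∀ m : ℕ, HodgeConjectureFor ((m + 1) * 2) ((C₁ ⊗ C₂).pow (m + 1)) := by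
  -- dimension bookkeeping `1 + 1 = 2` done by `rw` (not by unfolding `HodgeConjectureFor`)
  have h := hc_of_exists_isDominatedByPowers_abelianVariety hAV (hC₁.tensor_holds hC₂)
    (exists_isDominatedByPowers_tensor hC₁ hC₂ (exists_isDominatedByPowers_curve hC₁)
      (exists_isDominatedByPowers_curve hC₂))
  rwa [show (1 : ℕ) + 1 = 2 from rfl] at h

/-- **`HC_AV` ⟹ the Hodge conjecture for `C ⊗ Y` and all its powers**, for a curve `C` and any `Y` dominated by the
powers of an abelian variety (curves, abelian varieties, their products: the closure lemmas; e.g. `C × A`,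
`C₁ × C₂ × C₃`, …). [cite: Arapura2006, §1 Lemma 1.3 and §4 Lemma 4.2] -/
theorem hc_curve_tensor_of_hc_av (hAV : HC_AV) (hC : IsSmoothProjective 1 C) (hY : IsSmoothProjective dY Y)
    (h : ∃ A : AbelianVariety ℂ, IsDominatedByPowers dY Y A.dim A.X) :
    HodgeConjectureFor (1 + dY) (C ⊗ Y) ∧ ∀ m : ℕ, HodgeConjectureFor ((m + 1) * (1 + dY)) ((C ⊗ Y).pow (m + 1)) :=
  hc_of_exists_isDominatedByPowers_abelianVariety hAV (hC.tensor_holds hY)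
    (exists_isDominatedByPowers_tensor hC hY (exists_isDominatedByPowers_curve hC) h)

end Consequences

end Summit.HodgeConjecture.CorCM.Stage4

end
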